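import Summits.ResolutionOfSingularities.ResolutionOfSingularities.Theorems.CrossCutCells2
import Summits.ResolutionOfSingularities.ResolutionOfSingularities.Theorems.DeepCrossCutKernels3
import Summits.ResolutionOfSingularities.ResolutionOfSingularities.Theorems.DeepCrossCutKernelsCross
import Literature.AlgebraicGeometry.Resolution.HironakaTauScheme
import Literature.AlgebraicGeometry.Resolution.BlowupSequences
import Literature.AlgebraicGeometry.Resolution.MarkedIdeals
import Literature.AlgebraicGeometry.Resolution.StalkSpecializesLocalization
import Mathlib.Algebra.CharP.Defs
import Mathlib.Algebra.CharP.Lemmas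
import Mathlib.Data.Nat.Multiplicity
import Mathlib.AlgebraicGeometry.Morphisms.Smooth
import HarnessLib

/-!
# DeepCrossCutClasses — decomp-res node «DeepCrossCut» (lens-2 g22 rev8), file 1/2 of `DeepCrossCutClasses`

[WRITER NOTE (decomp-res writer g11).  Content VERBATIM from the decomp-res lens-2 g22 node
`HOME/decomp-res-lens-2/g22/DeepCrossCut.lean` rev8 (pin 8b8ca19c, 5 810 l; HOME = run/shared/lean/pub/decomp-res);
CRITIC-LEDGER row 180 CLEARED ((X**) `DeepCrossExit` DECIDED-MOD-PORT(M+) +1, MAP +1 (b′) fan game; rev8 = rev7 +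
the ONE residue-characteristic-2 GUARD of row 175 (d″)(α′)); landing orders row 180 / critic INBOX :875: l. 143–4449
of the lens file are the earlier lens-2 nodes RESTATED VERBATIM-IN-BODY (landed as `PurityCut*`, `SplitCut*`,
`CylinderCut*`, `SpreadCut*`, `CrossCut*`, `MaxContactCut{PurityCut,SplitCut,CylinderCut,SpreadCut,CrossCut}`) and
are NOT restated here — the landed modules are imported and opened instead; §Y.0 (ring level) + the inhabitant
kernels landed earlier from g21 as `DeepCrossCutKernels`, `…2`, `…3` (+ `DeepCrossCutKernelsCross`, the four
cross-weight comparisons); THIS chain is the NEW scheme layer §Y.2 + §Y.4–§Y.7 only, namespace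
`…Theses.DeepCrossCut` ↦ `…Theorems.DeepCrossCut`, split cone-free (`DeepCrossCutClasses*`, `DeepCrossCutCells*`) /
Theses-cone (`MaxContactCutDeepCrossCut*`), files ≤ 400 lines, `--supports stmt-ResolutionOfSingularities-29273`
(`MaxContactCut.RungOne`).  Column bookkeeping (row 180): ONE aside SWITCH on the lens-2 column to
`Deep.DeepSpecialRung` (home `DeepCrossCutCells*`), SUPERSEDING rev 50's aside 33866 `MaxContactCut.LeafSpecialRung`
via the exact re-locations.  The lens header is kept verbatim below.]

# DeepCrossCut — LAW (X**): THE DEEP CROSS, DECIDED ON THE BED BY A GREEDY INTRINSIC STRATEGY WITH A TERMINATION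
MEASURE, and LAW (N):
# THE NODE (critic window g21, CRITIC-LEDGER row
160 (d) — «X** decided as a whole: every two-branch tangle of the lineage's shape at arbitrary flat depth `d ≥ m`,
termination measure,
new crosses in the `V`-chart fibre controlled, INSEP-vv7 = `Z² + x⁵ + t²y⁷` decided concretely, EXACT re-location of
`Cross.CrossSpecialRung`»).
PLACEMENT: (d) is met ON THE BED — the class is typed at every depth at once; the strategy S3′ is intrinsic and
uniform in `(m, d)`; LEMMA Y.C
(paper proof) turns every S3′ run on a bed member into an explicit parity game on unimodular fans; (T1) its centres
straddle, (T2) PEEL LEMMA: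
its nodal phase is finite, (T4) TERMINATION THEOREM: its Euclid phase is finite by a WELL-FOUNDED MEASURE (the
multiset of the weights
`max |ord_D x^A − ord_D x^B|` of the `τ = 1` lines, strictly decreasing in the Dershowitz–Manna order at every move)
— so for EVERY odd
`3 ≤ m ≤ d` the package exists and exits (the new crosses of the `V`-chart fibre are moves of the same game);
INSEP-vv7 is certified chart by
chart; the TAIL LEMMA (T5) carries the tails `g ≠ 0` and the units along the bed's package (strict Newton domination
over `T`, tangential
witnesses by parity; cross-checked by 2705 Gröbner runs with tails, §Y.1 EVIDENCE (e)) and every other member of `I`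
by convexity — the letter's
member bound RE-TYPED (rev7, critic row 168 (d′)(α)) to the NEWTON MEMBER IDEAL `deepNewt` (g20's weaker
triply-weighted bound would need
the lattice LEMMA J♯ — finite-checked only, NOT claimed, REMARK of (T5) STEP 3; such points sit in the residual); the
re-location is exact.  NOT met: a KERNEL proof of (X**) — the typed `DeepCrossExit` stays a hypothesis of the
kernels (tag DECIDED (paper) ·
KERNEL PORT OPEN).  LAW (N) is decided whole-class on paper.
rev8 (g22 — critic row 175 (d″)(α′), the ONE re-pin asked): the class `IsUniformDeepCross` now carries the
RESIDUE-CHARACTERISTIC-2 GUARD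
along `T` (`∀ x, (η₁ ⤳ x ∨ η₂ ⤳ x) → ringChar (ResidueField (Y.presheaf.stalk x)) = 2`; kernels
`ringChar_eq_two_of_isUniformDeepCross`,
`ringChar_residueField_eq_two_of_two_eq_zero`; Probe C24 control, P26 must-fail) — the typed engine `DeepCrossExit`
(type text unchanged) now
quantifies over exactly the data the paper decision covers; the unguarded class is inhabited in residue
characteristic `3` (row 175's
non-principal `𝔽₃` datum) and such points fall into the located residual by complement; the SCOPE line of §Y.1 is
re-pinned (residue
characteristic `2` along `T`; local rings of any characteristic; residue fields arbitrary) and (T5) carries the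
wording precisions p1 (order-`2`
and `τ = 1` loci of `f^*` are the bed's up to the torus scaling of `ε₁(y), ε₂(y)`; centres identical) and p2 (the
units bracket of STEP 2 after
re-centring); NOTHING ELSE CHANGED (every other statement, kernel and `Deep.closes` verbatim from rev7 607dfe85).
KERNEL COMPANION (g22, MAP
(b′)): `HOME/decomp-res-lens-2/g22/FanGame.lean` proves IN KERNEL the fan game's local table, (T1), the (T4) TERMINATION THEOREM
(Dershowitz–Manna decrease + well-foundedness), S3′ as a program and 35 exit certificates `ℓ(m,d)` by `decide`
(landable `Theorems/DeepCrossCutFanGame*.lean`).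

## §0  CLAIMS AGAINST THE WINDOW (row 160 (d))
(i) PAPER: §Y.1 (N) — the node engine, re-derivable (three charts, two enumerations of tail monomials, one
quadratic-form remark); §Y.1 (X**)
— the greedy strategy S3 stated intrinsically, the identity `deep_towerOne` showing where g20's package stops, LEMMA
Y.C (the order-`2` /
`τ = 1` loci of every chart of every S3 run on the bed, by a parity calculus: the run IS a game on fans), the
structure theorems (T1) special
⇒ straddling, (T2) PEEL LEMMA, (T3) the Euclid phase and why the free game diverges, (T4) the TERMINATION THEOREM
with its measure, the
INSEP-vv7 package with its ten chart identities and the certificate; what is NOT proved is said (tails along S3′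
packages).  (ii) TYPED: `nodeWt`,
`NodeShape`, `PivotShape`, `deepWt`, `DeepCrossShape` (rev ≤ 6 / g20-style, `= CrossShape` at `d = m`:
`deepCrossShape_self_iff`), `deepNewt`,
`DeepCrossNewtShape` (THE letter, `→ DeepCrossShape`), `pairWt`, `SteepPairShape` (ring); `IsNodeAt`, `IsPivotAt`,
`IsUniformNode`,
`NodeExit`, `IsNodePt`, `IsDeepCrossAt` (`→ IsCrossAt` at `d = m`), `IsSteepPairAt`,
`IsUniformDeepCross`, `DeepCrossExit`, its certified instance `DeepCrossExit57`, `IsDeepCrossPt` (scheme); the cut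
`Deep.*` over g20's
COMPONENT port — 0 sorry.  (iii) EXACT RE-LOCATION: `Deep.crossSpecialRung_iff_deepSpecialRung : DeepGenericRung →
(Cross.CrossSpecialRung ↔
Deep.DeepSpecialRung)`, `Deep.closes : DeepGenericRung → DeepSpecialRung → MaxContactCut.RungOne` BY NAME,
`Deep.rungOne_iff` (EXACT at the
rung); the whole chain g14 … g20 and the tree asides 33865/33866 re-located too (§Y.7).  (iv) INHABITANTS DECIDED
CONCRETELY: INSEP-vv7
(deep-cross letter `deepCrossShape_insepVV7`, both branches in the order-`2` locus `insepVV7_mem_sq_steep/flat`, the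
nine-step package and
its ten charts `insepVV7_chart0…9`, certificate `explore/CERT-insepvv7.txt`); the node `z² + uts + u⁵`
(`nodeShape_nodalN`, one peel).

## §1  THE LAWS.  (X**) A UNIFORM DEEP CROSS (`IsUniformDeepCross I 2 q d η₁ η₂`): a steep top curve `C₁` and a flat
top curve `C₂` meeting
transversally inside a regular surface, `T = C₁ ∪ C₂` open in the order-`2` locus, letters: DEEP-CROSS at the tangle
(`z² + ε₁u₁^m +
ε₂v²u₂^d + deepWt`-tail, `m = 2q+1 ≤ d` odd), STEEP-PAIR along `C₁ ∖ C₂` (`z² + ε₁x^m + ε₃y^d + …`), FLANK along `C₂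
∖ C₁` (g20).  (N) A
UNIFORM NODE (`IsUniformNode I 2 η₁ η₂`): two top curves crossing transversally inside a regular surface, letter `z²
+ ε·uts + nodeWt c 7` at
the crossings (`τ = 1`), pivot letter `z² + ε′ut + (z,u,t)³` elsewhere (`τ = 3`).

## §2  THE ENGINES.  (N) `NodeExit` — DECIDED: blow up ONE branch; over the node exactly two top points survive, with
`in₂ = Z² + ε̄·T̃S + …` resp. `Z² + ε̄·U′S + …` (no `T̃²`, resp. `U′²`): `τ ≥ 2`; over pivot points nothing of order
`2`; MECHANISM in one
sentence: the node's `τ = 1` is carried by the PRODUCT `uts` of three parameters, and dividing by one branch turns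
it into the product of TWO,
which is a rank-`≥ 2` quadratic form — whereas a point blow-up divides by one parameter and multiplies back by it
(`node_pointChart`).
(X**) `DeepCrossExit` — DECIDED (paper) · KERNEL PORT OPEN: the GREEDY INTRINSIC STRATEGY S3′ (top plane ≻ `τ = 1`
line of maximal order, ties by maximal
`|δ_D| + |δ_{D′}|` ≻ peel at an isolated `τ = 1` point ≻ exit), §Y.1 (X**); MECHANISM: the deep game is BINOMIAL
(`Z² + x^A + x^B` in every
chart); LEMMA Y.C makes the bed run an explicit parity game on unimodular fans; its `τ = 1` lines straddle the
hyperplane `ord x^A = ord x^B`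
(T1), its nodal phase is finite (T2), and the multiset of line weights `max(|δ_D|, |δ_{D′}|)` strictly decreases at
every line blow-up (T4) —
TERMINATION and EXIT for every odd `3 ≤ m ≤ d`; the `620` pairs `m ≤ 41`, `d ≤ m+60` are also played out (`ℓ ≤ 367`, periodicity
`ℓ(m, d + 2m) = ℓ(m, d) + m`), and INSEP-vv7 is certified ideal-theoretically (9 steps).

## §3  INHABITANTS ON BOTH SIDES (NODE-g21 §3): engine side — INSEP-vv7's tangle and every point of its two top
curves (deep-cross points,
`(q,d) = (2,7)`), every bed binomial `z² + u₁^m + v²u₂^d` (`d ≥ m` odd), the node `z² + uts + u⁵` and its two top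
lines, besides all of g20's
decided classes; residual side — INSEP-v³'s core (cusp, E**), `R1-notail`, Iso/Sing points, even depths, every
deep-special point at a marking
`≠ 2` (`isDeepSpecialPt_iff_of_ne_two`).

## §4  PIECES AND TAGS (BY NAME).  `Deep.DeepGenericRung` — WEAKER · DECIDED-MOD-PORT(M+)·MOD-(X**)
(`Deep.deepGenericRung_of_ports`: the tree
engines (V)(D)(U)(R)(N), (M)(C)(G)(S)(JCyl)(Γ)(X), the NEW (N) and the NEW (X**) — each DECIDED on paper in its node
(for (X**): game +
(T4) + TAIL LEMMA (T5)) —, X1 via the tree aside 30081, g20's COMPONENT port (COSTUME(M+)), `OrderOneContact`).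
`Deep.DeepSpecialRung` — THE LOCATED
RESIDUAL: WEAKER BY LETTER than `Cross.CrossSpecialRung` (`Deep.deepSpecialRung_of_crossSpecialRung`,
hypothesis-free) · UNDECIDED · IDEA-NEEDED ·
cofinal (`Deep.deepSpecialRung_iff_rungOne`) ⇒ score 0.  `NodeExit` — DECIDED (paper) · port L · ATTACKABLE.
`DeepCrossExit` — DECIDED (paper:
LEMMA Y.C + (T1)(T2)(T4) on the bed, every odd `3 ≤ m ≤ d`; TAIL LEMMA (T5) for tails, units and every member of `I` —
Newton member ideal, convexity) · KERNEL PORT OPEN (ATTACKABLE: the fan game and (T4) are decidable combinatorics,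
(T5) is weight bookkeeping) · its instance `DeepCrossExit57` DECIDED twice over (measure; certificate) · port L.
`IsNodePt` — ATTACKABLE/decided leaf; `IsDeepCrossPt` — DECIDED(paper)/ATTACKABLE leaf; `IsDeepSpecialPt` —
IDEA-NEEDED leaf.  EQUIV layer:
exactly one (`Deep.rungOne_iff`), the split beneath it = decided-mod-engines half ∧ located residual.  WHY NOVEL:
every engine of the lineage
and of the tree is a FIXED TOWER read off a letter (a normal form decides the package in advance); (X**) is the
first engine of the programme
that is a STRATEGY — a greedy rule on intrinsic strata of the (order, τ)-stratification, uniform in the discrete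
invariants `(m, d)`, whose
packages have unbounded, datum-dependent length (`ℓ(11,17) = 45`, `ℓ(39,59) = 367`) — proved to terminate by a NEW
KIND OF MEASURE for the
programme: not a local invariant of a point but a multiset attached to the whole configuration of `τ = 1` lines,
decreasing in the
Dershowitz–Manna order, where the tie-break of the strategy is exactly what the key step of the proof needs (the
free game diverges); the
observation that makes it provable is that the whole two-branch game is BINOMIAL, and LEMMA Y.C turns «run S3′ on
the bed» into a parity
calculus on unimodular fans; (N) isolates the simplest tangle that no point-centred package can decide and decides
it by one peel.

## §5  WHAT IS LEFT (located, booked — NODE-g21 §7): a KERNEL port of (X**) — the fan game and (T4) (decidable: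
`decide`-certificates per `(m,d)`, the measure as a `Multiset ℕ` under `Multiset` Dershowitz–Manna), optionally the
lattice LEMMA J♯ of (T5) STEP 3's
REMARK (it would admit g20's weaker member bound into the decided class; finite-checked, general proof open) and the
weight bookkeeping of (T5) against
the tree's `CentreSeq` / `WeakAdmissible` —; general binomial data `Z² + x^A + x^B`
(only `A = (m,0,0)`, `B = (0,d,2)` is treated); E** — ONE CUSPIDAL branch (INSEP-v³ `z² + u(w⁵ + v³ + u²)` at stage
2; instrument
`explore/bgame.py`, the carrier calculus of NOTES; not claimed); crosses and nodes at markings `n ≥ 3`; EVEN flat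
depths (`τ = 2` / re-preparation); tangential or
singular branches; three or more branches through a point (the pure node `z² + uts`); top SURFACES through the core
(tree 30458);
`m ≢ −1 (mod n)`; mixed faces; NON-PRINCIPAL `I_y` beyond the letters (window (b)); Sing / Iso.

## This file

§Y.2 (rev8) point / curve level — the node letters (N) (`IsNodeAt` / pivot), the deep-cross letters (X**)
(`IsDeepCrossAt`, steep pair), the uniform classes incl. the rev8 GUARDED `IsUniformDeepCross` (residue
characteristic 2 — critic row 175 (d″)(α′); the 𝔽₃ non-principal datum of the unguarded class is residual by
complement) with its two `ringChar_*` kernels, the ENGINES `def DeepCrossExit : Prop` / node engine (paper engines: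
hypotheses, untagged `def … : Prop`, DECIDED-MOD-PORT(M+) by row 180 — the kernel half of the (X**) decision is the
fan game `Theorems/DeepCrossCutFanGame*`), `IsDeepCrossPt` / `IsNodePt` and the decided classes (continued `…2`
where the 400-line cap cuts).  The §Y.0 ring kernels and the inhabitant kernels are ALREADY in the tree
(`DeepCrossCutKernels`, `…2`, `…3`, `DeepCrossCutKernelsCross`, same namespace) and are not restated.

Part 1/2 carries: `isTopComponent_of_branches`, `IsNodeAt`, `IsPivotAt`, `IsUniformNode`, `NodeExit`, `IsNodePt`,
`eq_two_of_isNodePt`, `idealOrder_eq_of_isNodePt`, `isTopComponent_of_isUniformNode`, `isComponentExitPt_of_isNodePt`.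

(Sources: Hironaka1964 Ch. III; CossartJannsenSaito2020 Ch. 2, Ch. 8–9; CossartPiltant2008 Prop. 4.2;
CossartPiltant2019 Rem. 3.2; BierstoneGrigorievMilmanWlodarczyk2011 §3.1; Moh1987; Hauser2010Kangaroo; Giraud1975;
Narasimhan1983; DershowitzManna1979.)
-/

open CategoryTheory AlgebraicGeometry TopologicalSpace IsLocalRing
open Literature.AlgebraicGeometry.Resolution
open Summit.ResolutionOfSingularities.ResolutionOfSingularities.Theorems
open Summit.ResolutionOfSingularities.ResolutionOfSingularities.Theorems.WeakOrderReduction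
open Summit.ResolutionOfSingularities.ResolutionOfSingularities.Theorems.DeltaFaceCutClasses
open Summit.ResolutionOfSingularities.ResolutionOfSingularities.Theorems.RelativeDeltaCut
open Summit.ResolutionOfSingularities.ResolutionOfSingularities.Theorems.CurveLeafExit
open Summit.ResolutionOfSingularities.ResolutionOfSingularities.Theorems.PinchCut
open Summit.ResolutionOfSingularities.ResolutionOfSingularities.Theorems.JetCut
open Summit.ResolutionOfSingularities.ResolutionOfSingularities.Theorems.PurityCut
open Summit.ResolutionOfSingularities.ResolutionOfSingularities.Theorems.SplitCut
open Summit.ResolutionOfSingularities.ResolutionOfSingularities.Theorems.CylinderCut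
open Summit.ResolutionOfSingularities.ResolutionOfSingularities.Theorems.SpreadCut
open Summit.ResolutionOfSingularities.ResolutionOfSingularities.Theorems.CrossCut
open MvPolynomial

namespace Summit.ResolutionOfSingularities.ResolutionOfSingularities.Theorems.DeepCrossCut

/-! ### §Y.2  point / curve level — the node letters (N) (Pv), the deep-cross letters (X**) (SP), the uniform
classes, ENGINES (N) and
(X**), the decided / instrumented classes -/

/-- **TWO BRANCHES FORM A TOP COMPONENT** [g21; KERNEL (PROVED), g20's `isTopComponent_of_isUniformCross` with the
letters stripped]:
`T = closure {η₁} ∪ closure {η₂}` is closed and preconnected (two irreducible closed sets through a common point),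
and the order /
clopen clauses are carried over. [folklore] -/
theorem isTopComponent_of_branches {Y : Scheme.{0}} {I : Y.IdealSheafData} {n : ℕ} {η₁ η₂ : Y}
    (hmeet : ∃ x : Y, η₁ ⤳ x ∧ η₂ ⤳ x)
    (hT : ∀ x : Y, (η₁ ⤳ x ∨ η₂ ⤳ x) → idealOrder I x = ((n : ℕ) : ℕ∞))
    (hU : ∃ U : Y.Opens, (∀ x : Y, (η₁ ⤳ x ∨ η₂ ⤳ x) → x ∈ U) ∧
      ∀ x : Y, x ∈ U → idealOrder I x = ((n : ℕ) : ℕ∞) → (η₁ ⤳ x ∨ η₂ ⤳ x)) :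
    IsTopComponent I n {x : Y | η₁ ⤳ x ∨ η₂ ⤳ x} := by
  obtain ⟨x₀, hx₁, hx₂⟩ := hmeet
  obtain ⟨U, hTU, hUT⟩ := hU
  have e₁ : {x : Y | η₁ ⤳ x} = closure ({η₁} : Set Y) := Set.ext fun x => specializes_iff_mem_closure
  have e₂ : {x : Y | η₂ ⤳ x} = closure ({η₂} : Set Y) := Set.ext fun x => specializes_iff_mem_closure
  have hu : {x : Y | η₁ ⤳ x ∨ η₂ ⤳ x} = {x : Y | η₁ ⤳ x} ∪ {x : Y | η₂ ⤳ x} := by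
    ext x
    simp
  refine ⟨fun x hx => hT x hx, ?_, ?_, ⟨U, fun x hx => hTU x hx, fun x hx hox => hUT x hx hox⟩⟩
  · rw [hu, e₁, e₂]
    exact isClosed_closure.union isClosed_closure
  · have h₁ : _root_.IsPreconnected {x : Y | η₁ ⤳ x} := by
      rw [e₁]
      exact isPreconnected_singleton.closure
    have h₂ : _root_.IsPreconnected {x : Y | η₂ ⤳ x} := by
      rw [e₂]
      exact isPreconnected_singleton.closure
    rw [hu]
    exact IsPreconnected.union x₀ hx₁ hx₂ h₁ h₂

/-- **NODE-SHAPED at `y`, the crossing point of the branches `η₁`, `η₂`** [g21] (`IsNodeAt I η₁ η₂ y`): a minimal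
system `c = (z, u, t, s)`
of `𝔪_y` (`spanFinrank = 4`) with `(z,u,t)` generating `curvePrime (η₁ ⤳ y)` and `(z,u,s)` generating `curvePrime
(η₂ ⤳ y)` — both
branches regular at `y`, transversal inside the regular surface `V(z,u)` — and `I_y` of NODE SHAPE in this frame.
DEFINITION (NEW class
predicate). (Sources: Hironaka1967; CossartJannsenSaito2020 Ch. 2, Ch. 8.) -/
def IsNodeAt {Y : Scheme.{0}} (I : Y.IdealSheafData) (η₁ η₂ y : Y) : Prop :=
  ∃ (h₁ : η₁ ⤳ y) (h₂ : η₂ ⤳ y) (c : Fin 4 → Y.presheaf.stalk y),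
    Ideal.span {c 0, c 1, c 2} = curvePrime h₁ ∧ Ideal.span {c 0, c 1, c 3} = curvePrime h₂ ∧
      Ideal.span (Set.range c) = maximalIdeal (Y.presheaf.stalk y) ∧
      (maximalIdeal (Y.presheaf.stalk y)).spanFinrank = 4 ∧
      NodeShape (stalkIdeal I y) c

/-- **PIVOT-SHAPED at `y` along the branch `η`** [g21] (`IsPivotAt I η y`): a minimal system `c = (z, u, t, s)` of
`𝔪_y` with `(z,u,t)`
generating `curvePrime (η ⤳ y)` and `I_y` of PIVOT SHAPE (`z² + ε·u·t + (z,u,t)³`, members in `(z,u,t)²`): `τ(y) =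
3`, and the blow-up
of the branch leaves no order-`2` point over `y`.  DEFINITION (NEW class predicate). (Sources: Hironaka1967;
CossartJannsenSaito2020 Ch. 2.) -/
def IsPivotAt {Y : Scheme.{0}} (I : Y.IdealSheafData) (η y : Y) : Prop :=
  ∃ (h : η ⤳ y) (c : Fin 4 → Y.presheaf.stalk y),
    Ideal.span {c 0, c 1, c 2} = curvePrime h ∧
      Ideal.span (Set.range c) = maximalIdeal (Y.presheaf.stalk y) ∧
      (maximalIdeal (Y.presheaf.stalk y)).spanFinrank = 4 ∧
      PivotShape (stalkIdeal I y) c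

/-- **UNIFORM NODE** [g21] (`IsUniformNode I n η₁ η₂`) — THE UNIT OF ENGINE (N): marking `n = 2`; two DISTINCT curve
points whose closures
MEET; `T = C₁ ∪ C₂` lies in the order-`n` locus and is OPEN in it; and at every CLOSED point of `T` the letter of
its position: node letter at
the points of `C₁ ∩ C₂`, pivot letter (`τ = 3`) along `C₁ ∖ C₂` and along `C₂ ∖ C₁`.  DEFINITION (NEW class predicate). -/
def IsUniformNode {Y : Scheme.{0}} (I : Y.IdealSheafData) (n : ℕ) (η₁ η₂ : Y) : Prop :=
  n = 2 ∧ η₁ ≠ η₂ ∧ IsCurvePt η₁ ∧ IsCurvePt η₂ ∧ (∃ x : Y, η₁ ⤳ x ∧ η₂ ⤳ x) ∧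
    (∀ x : Y, (η₁ ⤳ x ∨ η₂ ⤳ x) → idealOrder I x = ((n : ℕ) : ℕ∞)) ∧
    (∃ U : Y.Opens, (∀ x : Y, (η₁ ⤳ x ∨ η₂ ⤳ x) → x ∈ U) ∧
      ∀ x : Y, x ∈ U → idealOrder I x = ((n : ℕ) : ℕ∞) → (η₁ ⤳ x ∨ η₂ ⤳ x)) ∧
    ∀ y : Y, IsClosed ({y} : Set Y) →
      (η₁ ⤳ y → η₂ ⤳ y → IsNodeAt I η₁ η₂ y) ∧
      (η₁ ⤳ y → ¬ η₂ ⤳ y → IsPivotAt I η₁ y) ∧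
      (η₂ ⤳ y → ¬ η₁ ⤳ y → IsPivotAt I η₂ y)

/-- **ENGINE (N) `NodeExit`** [g21; DECIDED · paper proof = module docstring §Y.1 (N) (ONE blow-up, of the branch
`C₁ = closure {η₁}`:
intrinsic, regular, inside the order-`2` locus — weakly admissible; over the nodal point the three charts
`node_tChart` / `node_uChart` /
`node_zChart` leave exactly two top points, both with `in₂ ∋ Z̄² + ε̄·(two independent linear forms)`: `τ ≥ 2`
(indeed `3`), the tail
`nodeWt c 7` contributing nothing of order `≤ 2` at them; over the pivot points of `C₁` NO order-`2` point
(`pivot_tChart`, `pivot_zChart`: a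
linear term survives); the points of `C₂ ∖ C₁` are untouched and keep `τ = 3`) · `n = 2` · characteristic free ·
every regular scheme of
dimension four along `T` · port L only (blow-up charts, controlled transform, `gr` of a regular local ring)]: on a
regular scheme, a uniform
node has an exit package with centres over `T = C₁ ∪ C₂`.  STATEMENT (engine). (Sources: Hironaka1967;
CossartJannsenSaito2020 Ch. 2, Ch. 8;
CossartPiltant2008 Prop. 4.2; BierstoneGrigorievMilmanWlodarczyk2011 §3; StacksProject Tag 0805.) -/
def NodeExit : Prop :=
  ∀ (Y : Scheme.{0}), Scheme.IsRegular Y → ∀ (I : Y.IdealSheafData) (n : ℕ) (η₁ η₂ : Y),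
    IsUniformNode I n η₁ η₂ → PackageExitsOver I n {x : Y | η₁ ⤳ x ∨ η₂ ⤳ x}

/-- **NODAL point** [g21] (NEW DECIDED CLASS, leaf (N)): `y` lies on (or is a generic point of a branch of) a
uniform node.  Inhabitant:
`z² + uts + u⁵` on `𝔸⁴_{𝔽₂}` (`nodeShape_nodalN`; NODE-g21 §3) and every point of its two top lines.  NOT
Top-isolated, and NOT decided by
any POINT blow-up (`node_pointChart`: the node regenerates): new territory for every point port and curve port of the tree.
DEFINITION (NEW class). -/
def IsNodePt {Y : Scheme.{0}} (I : Y.IdealSheafData) (n : ℕ) (y : Y) : Prop :=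
  ∃ (η₁ η₂ : Y), (η₁ ⤳ y ∨ η₂ ⤳ y) ∧ IsUniformNode I n η₁ η₂

/-- The node class lives at marking `2` only.  KERNEL (PROVED; letter bookkeeping). [folklore] -/
theorem eq_two_of_isNodePt {Y : Scheme.{0}} {I : Y.IdealSheafData} {n : ℕ} {y : Y} (h : IsNodePt I n y) : n = 2 := by
  obtain ⟨_, _, _, hn, _⟩ := h
  exact hn

/-- A nodal point is a top point.  KERNEL (PROVED). [folklore] -/
theorem idealOrder_eq_of_isNodePt {Y : Scheme.{0}} {I : Y.IdealSheafData} {n : ℕ} {y : Y} (h : IsNodePt I n y) :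
    idealOrder I y = ((n : ℕ) : ℕ∞) := by
  obtain ⟨_, _, hy, _, _, _, _, _, hT, _, _⟩ := h
  exact hT _ hy

/-- **A UNIFORM NODE IS A TOP COMPONENT** [g21; KERNEL (PROVED)]. [folklore] -/
theorem isTopComponent_of_isUniformNode {Y : Scheme.{0}} {I : Y.IdealSheafData} {n : ℕ} {η₁ η₂ : Y}
    (h : IsUniformNode I n η₁ η₂) : IsTopComponent I n {x : Y | η₁ ⤳ x ∨ η₂ ⤳ x} := by
  obtain ⟨_, _, _, _, hmeet, hT, hU, _⟩ := h
  exact isTopComponent_of_branches hmeet hT hU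

/-- **ENGINE (N) AT WORK, pointwise** [g21; KERNEL (PROVED)]: under `NodeExit`, every nodal point of a regular
scheme is a component-exit
point of g20's component port. [folklore] -/
theorem isComponentExitPt_of_isNodePt {Y : Scheme.{0}} {I : Y.IdealSheafData} {n : ℕ} {y : Y}
    (hN : NodeExit) (hY : Scheme.IsRegular Y) (h : IsNodePt I n y) : IsComponentExitPt I n y := by
  obtain ⟨η₁, η₂, hy, hU⟩ := h
  exact ⟨{x : Y | η₁ ⤳ x ∨ η₂ ⤳ x}, hy, isTopComponent_of_isUniformNode hU, hN Y hY I n η₁ η₂ hU⟩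

end Summit.ResolutionOfSingularities.ResolutionOfSingularities.Theorems.DeepCrossCut
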